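import Literature.Algebra.Polynomial.UmbralComposition
import Literature.Algebra.Polynomial.BasicSequenceGeneratingFunctions
import Literature.Algebra.Polynomial.TouchardStirlingDobinski
import Literature.Algebra.Polynomial.LaguerreBasicSequence
import Mathlib.Algebra.Group.ForwardDiff
import Mathlib.Tactic
import HarnessLib

/-!
# Inverse pairs under umbral composition: factorials and exponential polynomials, the Abel polynomials and their inverse set, Laguerre polynomials

The worked instances of Rota–Kahaner–Odlyzko's §7 (Theorem 7 and Corollaries 3, 6, 7: inverse sets,
`p_n (x) = Σ_k xᵏ/k! [Qᵏ xⁿ]_{x=0}`, the summation formula) printed in §§11, 14 of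
*Finite operator calculus* (1973):

> §14, p. 747: "the exponential polynomials `φ_n (x)` … are the basic polynomials for the delta
> operator `log (I + D)`, and … they are inverse to `(x)_n`, so that `φ (φ − 1) ⋯ (φ − n + 1) = xⁿ`
> and `φ_n (x) = Σ_k S(n, k) xᵏ` …"; p. 748: "the connection constants with `xⁿ` are the Stirling
> numbers of the second kind. The connection constants between `xⁿ` and `φ_n (x)` are the Stirling
> numbers of the first kind, since the `φ_n (x)` are the inverse set of the `(x)_n`."
> §7, p. 711 (Corollary 7): "The prototype of this formula is the classical formula of Dobinski for
> the exponential polynomials."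
> §14, p. 745: "The inverse set to the Abel polynomials does not seem to have been considered …
> Let `B_n^{(a)} (x) = Σ_{k≥0} C(n,k) xᵏ (ka)^{n−k} = Σ_{k≥0} xᵏ/k! [E^{ka} Dᵏ xⁿ]_{x=0}`; from the
> summation formula we recognize that these are indeed the inverses of the Abel polynomials. Their
> umbral recursion formula is `B^{(a)} (x) (B^{(a)} (x) − na)^{n−1} = xⁿ`, and the identity stating
> that the two sets are inverse is `xⁿ = Σ_{k≥0} C(n,k) (ka)^{n−k} x (x − ka)^{k−1}`. The summation
> formula (Corollary 7 of Theorem 7) becomes [`f (B^{(a)} (x)) = Σ_k xᵏ/k! [E^{ka} Dᵏ f]_{x=0}`]."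
> §11, p. 729: "we apply Theorem 7 to study the umbral composition of two Laguerre polynomials. A
> trivial identification of the various operators at hand yields
> `L_n^{(α)} (L^{(β)} (x)) = (I − D)^{β−α} xⁿ` … For `β = α` we obtain the remarkable identity
> `L_n^{(α)} (L^{(α)} (x)) = xⁿ`, showing that all the Laguerre polynomials are self-inverse sets.
> This is true even of the basic Laguerre polynomials, which correspond to the case `α = −1`."
> §14, p. 748: "we shall connect the Laguerre polynomials with the polynomials `φ_n (−x)`. It is easy
> to see that the `φ_n (−x)` are basic for the delta operator `log (I − D)`. Thus, we must find a
> formal power series `f (t)` such that `f (log (1 − t)) = t/(t − 1)`. Clearly `f (t) = 1 − e^{−t}`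
> is the desired series. The connection constants are therefore given by the coefficients of the
> basic sequence for the backward difference operator `∇ = I − E^{−1}`, namely the polynomials
> `x (x + 1) ⋯ (x + n − 1)`."

Dictionary: `umbralComp a b n = a_n (b (x))` (`UmbralOperators`), `umbral b : xⁿ ↦ b_n`; the tree's
`descPochhammer K n = (x)_n`, `ascPochhammer K n = x (x+1)⋯(x+n−1)`, `touchardPolynomial K n = φ_n`,
`abelPolynomial a n = x (x − na)^{n−1}` (basic for `Eᵃ D = taylor a ∘ₗ derivative`),
`laguerreBasic K n = L_n` (basic for `K = D/(D − I) = (t (t−1)⁻¹)(D)`), `laguerreSheffer K m n =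
(I − D)^m L_n = L_n^{(m−1)}`, `Δ = taylor 1 − id`. The one definition is RKO's inverse Abel set
`inverseAbelPolynomial a n = B_n^{(a)} = Σ_k C(n,k) (ka)^{n−k} xᵏ`.

Main statements: `umbralComp_descPochhammer_touchardPolynomial` / `umbralComp_touchardPolynomial_descPochhammer`
(`(x)_n` and `φ_n` are inverse), `sum_coeff_descPochhammer_smul_touchardPolynomial` (Stirling numbers of the
first kind connect `xⁿ` to `φ_n`), `touchardPolynomial_eq_sum_forwardDifference_pow` /
`stirlingSecond_eq_forwardDifference_pow_eval_zero_div` (Corollary 6 for `Δ`: `S(n,k) = [Δᵏ xⁿ]₀/k!`),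
`umbral_touchardPolynomial_eq_sum` (Corollary 7, Dobinski's prototype `f (φ (x)) = Σ xᵏ/k! [Δᵏ f]₀`),
`basicSequence_diffOp_abelInverseSeries` / `isBasicSequence_inverseAbelPolynomial` (`B^{(a)}` is the basic set
of the compositional inverse of `t e^{at}`), `umbralComp_abelPolynomial_inverseAbelPolynomial`,
`umbralComp_inverseAbelPolynomial_abelPolynomial`, `X_pow_eq_sum_choose_mul_pow_smul_abelPolynomial` (the printed
identity), `inverseAbelPolynomial_eq_sum_taylor_comp_derivative_pow`, `umbral_inverseAbelPolynomial_eq_sum` (the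
summation formula), `X_mul_X_sub_one_inv_subst_self` (`t/(t−1)` is a compositional involution),
`umbralComp_laguerreBasic_self`, `umbralComp_laguerreSheffer`, `umbralComp_laguerreSheffer_self` (Laguerre sets
are self-inverse), `isBasicSequence_touchardPolynomial_comp_neg_X`, `one_sub_exp_neg_subst_log_one_sub`,
`laguerreBasic_eq_umbralComp_ascPochhammer` (`L_n (x) = ⟨φ (−x)⟩_n`).

## References
* [RotaKahanerOdlyzko1973] G.-C. Rota, D. Kahaner, A. Odlyzko, *On the foundations of
  combinatorial theory VIII. Finite operator calculus*, J. Math. Anal. Appl. 42 (1973) 684–760,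
  §7 Corollaries 3, 6, 7 (pp. 709–711), §11 (p. 729), §14 (pp. 745, 747–748).
* [Robert2000PadicAnalysis] A. M. Robert, *A Course in p-adic Analysis*, GTM 198, Springer (2000),
  Ch. IV §6.2–6.3 (the series `e^t − 1`, `log (1 + t)` and the Bell polynomials), pp. 209–212.
-/

noncomputable section

open Polynomial Finset
open scoped fwdDiff

namespace Literature.Algebra.Polynomial

variable (K : Type*) [Field K] [CharZero K]

/-! ## `(x)_n` and the exponential polynomials `φ_n` are inverse to each other -/

section Exponential

/-- `(x)_n` is the basic set of `Δ = (e^t − 1)(D)`. [cite: Robert2000PadicAnalysis, Ch. IV §6.2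
Example 1, p. 210] [cite: RotaKahanerOdlyzko1973, §14, p. 747] -/
theorem isBasicSequence_descPochhammer_diffOp :
    IsBasicSequence (diffOp (PowerSeries.exp K - 1)) (descPochhammer K) := by
  rw [← forwardDifference_eq_diffOp]
  exact isBasicSequence_descPochhammer

/-- **The exponential polynomials are inverse to the lower factorials**:
`φ (φ − 1) ⋯ (φ − n + 1) = xⁿ` umbrally, i.e. `Σ_k s(n,k) φ_k (x) = xⁿ` — since `e^{log (1+t)} − 1 = t`.
[cite: RotaKahanerOdlyzko1973, §14 ("they are inverse to `(x)_n`, so that `φ(φ−1)⋯(φ−n+1) = xⁿ`"),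
p. 747] [cite: RotaKahanerOdlyzko1973, §7 Corollary 3, p. 709] -/
theorem umbralComp_descPochhammer_touchardPolynomial (n : ℕ) :
    umbralComp (descPochhammer K) (touchardPolynomial K) n = X ^ n :=
  (isBasicSequence_descPochhammer_diffOp K).umbralComp_eq_X_pow_of_subst_eq_X isDeltaOperator_diffOp_log
    (isBasicSequence_touchardPolynomial K) exp_sub_one_subst_log n

/-- … and in the other order, `(φ (x))_n ↦`: `φ_n ((x)) = xⁿ`, i.e. `Σ_k S(n,k) (x)_k = xⁿ` — since
`log (1 + (e^t − 1)) = t`. (Coefficientwise this is the tree's `X_pow_eq_sum_stirlingSecond_descPochhammer`.)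
[cite: RotaKahanerOdlyzko1973, §14 ("the connection constants with `xⁿ` are the Stirling numbers of
the second kind"), pp. 747–748] [cite: RotaKahanerOdlyzko1973, §7 Corollary 3, p. 709] -/
theorem umbralComp_touchardPolynomial_descPochhammer (n : ℕ) :
    umbralComp (touchardPolynomial K) (descPochhammer K) n = X ^ n :=
  (isBasicSequence_touchardPolynomial K).umbralComp_eq_X_pow_of_subst_eq_X
    isDeltaOperator_diffOp_exp_sub_one (isBasicSequence_descPochhammer_diffOp K)
    log_subst_exp_sub_one n

/-- The umbral operators `xⁿ ↦ φ_n` and `xⁿ ↦ (x)_n` are inverse to each other.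
[cite: RotaKahanerOdlyzko1973, §14, pp. 747–749] -/
theorem umbral_touchardPolynomial_comp_umbral_descPochhammer :
    umbral (touchardPolynomial K) ∘ₗ umbral (descPochhammer K) = LinearMap.id :=
  (umbral_comp_umbral_eq_id_iff _ _).2 (funext (umbralComp_descPochhammer_touchardPolynomial K))

/-- … and `(xⁿ ↦ (x)_n) ∘ (xⁿ ↦ φ_n) = id`. [cite: RotaKahanerOdlyzko1973, §14, pp. 747–749] -/
theorem umbral_descPochhammer_comp_umbral_touchardPolynomial :
    umbral (descPochhammer K) ∘ₗ umbral (touchardPolynomial K) = LinearMap.id :=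
  (umbral_comp_umbral_eq_id_iff _ _).2 (funext (umbralComp_touchardPolynomial_descPochhammer K))

/-- **"The connection constants between `xⁿ` and `φ_n (x)` are the Stirling numbers of the first
kind, since the `φ_n (x)` are the inverse set of the `(x)_n`"**: `Σ_{k ≤ n} s(n,k) φ_k (x) = xⁿ`,
where `(x)_n = Σ_k s(n,k) xᵏ` (the signed Stirling numbers of the first kind, the tree's
`sgnStirling`). [cite: RotaKahanerOdlyzko1973, §14, p. 748] -/
theorem sum_coeff_descPochhammer_smul_touchardPolynomial (n : ℕ) :
    ∑ k ∈ range (n + 1), (descPochhammer K n).coeff k • touchardPolynomial K k = X ^ n := by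
  rw [← umbralComp_descPochhammer_touchardPolynomial K n,
    umbralComp_eq_sum _ _ n (by rw [descPochhammer_natDegree]; exact lt_add_one n)]

/-- **Orthogonality relations for the Stirling numbers**, read off from the inverse pair
("Stirling number identities can be inferred from identities relating the `φ_n (x)` and the
`(x)_n`"): `Σ_k s(n,k) S(k,m) = δ_{nm}` — the coefficient of `xᵐ` in `Σ_k s(n,k) φ_k (x) = xⁿ`.
[cite: RotaKahanerOdlyzko1973, §14 ("orthogonality relations for the Stirling numbers"), p. 749] -/
theorem sum_coeff_descPochhammer_mul_stirlingSecond (n m : ℕ) :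
    ∑ k ∈ range (n + 1), (descPochhammer K n).coeff k * (k.stirlingSecond m : K) =
      if m = n then 1 else 0 := by
  have h := congrArg (fun f : K[X] => f.coeff m) (sum_coeff_descPochhammer_smul_touchardPolynomial K n)
  simp only [finsetSum_coeff, coeff_smul, smul_eq_mul, coeff_touchardPolynomial, coeff_X_pow] at h
  exact h

/-- … and dually `Σ_k S(n,k) s(k,m) = δ_{nm}` — the coefficient of `xᵐ` in `Σ_k S(n,k) (x)_k = xⁿ`.
[cite: RotaKahanerOdlyzko1973, §14 ("orthogonality relations for the Stirling numbers"), p. 749] -/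
theorem sum_stirlingSecond_mul_coeff_descPochhammer (n m : ℕ) :
    ∑ k ∈ range (n + 1), (n.stirlingSecond k : K) * (descPochhammer K k).coeff m =
      if m = n then 1 else 0 := by
  have h := congrArg (fun f : K[X] => f.coeff m) (umbralComp_touchardPolynomial_descPochhammer K n)
  rw [umbralComp_eq_sum _ _ n (by rw [natDegree_touchardPolynomial (K := K) n]; exact lt_add_one n)] at h
  simp only [finsetSum_coeff, coeff_smul, smul_eq_mul, coeff_touchardPolynomial, coeff_X_pow] at h
  exact h

/-- **Corollary 6 for `Q = Δ`**: `φ_n (x) = Σ_{k ≤ n} xᵏ/k! · [Δᵏ xⁿ]_{x=0}`.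
[cite: RotaKahanerOdlyzko1973, §7 Corollary 6, p. 710] [cite: RotaKahanerOdlyzko1973, §14, p. 747] -/
theorem touchardPolynomial_eq_sum_forwardDifference_pow (n : ℕ) :
    touchardPolynomial K n = ∑ k ∈ range (n + 1),
      ((((taylor (1 : K) - LinearMap.id : K[X] →ₗ[K] K[X]) ^ k) (X ^ n)).eval 0 /
        (k.factorial : K)) • X ^ k :=
  eq_sum_of_umbralComp_eq_X_pow isDeltaOperator_taylor_sub_id isBasicSequence_descPochhammer
    (funext (umbralComp_descPochhammer_touchardPolynomial K)) n

/-- **Corollary 7 (Summation Formula) for the exponential polynomials** — "the prototype of this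
formula is the classical formula of Dobinski": for every polynomial `f` (`deg f < N`),
`f (φ (x)) = Σ_{k < N} xᵏ/k! · [Δᵏ f (x)]_{x=0}`, `f (φ (x))` being the umbral substitution
`xⁿ ↦ φ_n (x)`. [cite: RotaKahanerOdlyzko1973, §7 Corollary 7, p. 711] -/
theorem umbral_touchardPolynomial_eq_sum (f : K[X]) {N : ℕ} (hN : f.natDegree < N) :
    umbral (touchardPolynomial K) f = ∑ k ∈ range N,
      ((((taylor (1 : K) - LinearMap.id : K[X] →ₗ[K] K[X]) ^ k) f).eval 0 /
        (k.factorial : K)) • X ^ k :=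
  umbral_eq_sum_of_umbralComp_eq_X_pow isDeltaOperator_taylor_sub_id isBasicSequence_descPochhammer
    (funext (umbralComp_descPochhammer_touchardPolynomial K)) f hN

/-- **The Stirling numbers of the second kind as connection constants**:
`S(n,k) = [Δᵏ xⁿ]_{x=0} / k!` for all `n, k`. [cite: RotaKahanerOdlyzko1973, §14 ("`φ_n (x) =
Σ S(n,k) xᵏ`"), p. 747] [cite: RotaKahanerOdlyzko1973, §7 Corollary 6, p. 710] -/
theorem stirlingSecond_eq_forwardDifference_pow_eval_zero_div (n k : ℕ) :
    (n.stirlingSecond k : K) =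
      (((taylor (1 : K) - LinearMap.id : K[X] →ₗ[K] K[X]) ^ k) (X ^ n)).eval 0 /
        (k.factorial : K) := by
  have h := umbral_touchardPolynomial_eq_sum K (X ^ n) (N := max n k + 1)
    (by rw [natDegree_X_pow]; omega)
  rw [umbral_X_pow] at h
  have h2 := congrArg (fun f : K[X] => f.coeff k) h
  simp only [finsetSum_coeff, coeff_smul, coeff_X_pow, smul_eq_mul, mul_ite, mul_one,
    mul_zero] at h2
  rw [sum_ite_eq, if_pos (mem_range.2 (by omega)), coeff_touchardPolynomial] at h2
  exact h2

omit [CharZero K] in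
/-- The operator power `Δᵏ = (E − I)ᵏ` on `K[X]`, evaluated, is Mathlib's iterated forward
difference `Δ_[1]^[k]` of the polynomial function. [cite: RotaKahanerOdlyzko1973, §14, p. 747] -/
theorem forwardDifference_pow_apply_eval (k : ℕ) (f : K[X]) (x : K) :
    (((taylor (1 : K) - LinearMap.id : K[X] →ₗ[K] K[X]) ^ k) f).eval x =
      Δ_[(1 : K)]^[k] (fun y => f.eval y) x := by
  induction k generalizing x with
  | zero => rw [pow_zero, Module.End.one_apply, Function.iterate_zero_apply]
  | succ k ih =>
    rw [pow_succ', Module.End.mul_apply, LinearMap.sub_apply, LinearMap.id_apply, eval_sub,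
      taylor_eval, ih, ih, Function.iterate_succ_apply']
    rfl

omit [CharZero K] in
/-- `[Δᵏ xⁿ]_{x=0} = Σ_{j ≤ k} (−1)^{k−j} C(k,j) jⁿ`. [cite: RotaKahanerOdlyzko1973, §14, p. 747] -/
theorem forwardDifference_pow_X_pow_eval_zero (k n : ℕ) :
    (((taylor (1 : K) - LinearMap.id : K[X] →ₗ[K] K[X]) ^ k) (X ^ n)).eval 0 =
      ∑ j ∈ range (k + 1), ((-1 : ℤ) ^ (k - j) * (k.choose j : ℤ)) • (j : K) ^ n := by
  rw [forwardDifference_pow_apply_eval, fwdDiff_iter_eq_sum_shift]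
  refine sum_congr rfl fun j _ => ?_
  simp only [eval_pow, eval_X, zero_add, Nat.smul_one_eq_cast]

/-- Hence the explicit formula `S(n,k) = (Σ_{j ≤ k} (−1)^{k−j} C(k,j) jⁿ) / k!` in any field of
characteristic `0` (the integer form `k! S(n,k) = Σ …` is the tree's
`factorial_mul_stirlingSecond_eq_sum`). [cite: RotaKahanerOdlyzko1973, §14, pp. 747–748] -/
theorem stirlingSecond_eq_sum_div_factorial (n k : ℕ) :
    (n.stirlingSecond k : K) =
      (∑ j ∈ range (k + 1), ((-1 : ℤ) ^ (k - j) * (k.choose j : ℤ)) • (j : K) ^ n) /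
        (k.factorial : K) := by
  rw [stirlingSecond_eq_forwardDifference_pow_eval_zero_div, forwardDifference_pow_X_pow_eval_zero]

end Exponential

/-! ## The Abel polynomials and their inverse set `B_n^{(a)}` -/

section Abel

variable {K}

/-- **The inverse set of the Abel polynomials** (Rota–Kahaner–Odlyzko §14):
`B_n^{(a)} (x) = Σ_{k ≥ 0} C(n,k) (ka)^{n−k} xᵏ` (for `a = 1` the "idempotent" polynomials
`Σ_k C(n,k) k^{n−k} xᵏ`). [cite: RotaKahanerOdlyzko1973, §14 ("Let `B_n^{(a)} (x) =
Σ_{k≥0} C(n,k) xᵏ (ka)^{n−k}`"), p. 745] -/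
def inverseAbelPolynomial (a : K) (n : ℕ) : K[X] :=
  ∑ k ∈ range (n + 1), ((n.choose k : K) * ((k : K) * a) ^ (n - k)) • X ^ k

omit [CharZero K] in
/-- Unfolding `B_n^{(a)} = Σ_{k ≤ n} C(n,k) (ka)^{n−k} xᵏ`. [cite: RotaKahanerOdlyzko1973, §14, p. 745] -/
theorem inverseAbelPolynomial_eq_sum (a : K) (n : ℕ) :
    inverseAbelPolynomial a n =
      ∑ k ∈ range (n + 1), ((n.choose k : K) * ((k : K) * a) ^ (n - k)) • X ^ k :=
  rfl

omit [CharZero K] in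
/-- The coefficients of `B_n^{(a)}`: `[xᵏ] B_n^{(a)} = C(n,k) (ka)^{n−k}`.
[cite: RotaKahanerOdlyzko1973, §14, p. 745] -/
theorem coeff_inverseAbelPolynomial (a : K) (n k : ℕ) :
    (inverseAbelPolynomial a n).coeff k = (n.choose k : K) * ((k : K) * a) ^ (n - k) := by
  rw [inverseAbelPolynomial, finsetSum_coeff]
  simp only [coeff_smul, coeff_X_pow, smul_eq_mul, mul_ite, mul_one, mul_zero]
  rw [sum_ite_eq]
  split_ifs with h
  · rfl
  · rw [mem_range, not_lt] at h
    rw [Nat.choose_eq_zero_of_lt (by omega), Nat.cast_zero, zero_mul]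

omit [CharZero K] in
/-- `B_0^{(a)} = 1`. [cite: RotaKahanerOdlyzko1973, §14, p. 745] -/
theorem inverseAbelPolynomial_zero (a : K) : inverseAbelPolynomial a 0 = 1 := by
  rw [inverseAbelPolynomial, sum_range_one, Nat.choose_self, Nat.cast_one, one_mul, Nat.sub_zero,
    pow_zero, pow_zero, one_smul]

omit [CharZero K] in
/-- `B_1^{(a)} = x`. [cite: RotaKahanerOdlyzko1973, §14, p. 745] -/
theorem inverseAbelPolynomial_one (a : K) : inverseAbelPolynomial a 1 = X := by
  rw [inverseAbelPolynomial, sum_range_succ, sum_range_one]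
  simp

omit [CharZero K] in
/-- `B_2^{(a)} = x² + 2a x`. [cite: RotaKahanerOdlyzko1973, §14, p. 745] -/
theorem inverseAbelPolynomial_two (a : K) : inverseAbelPolynomial a 2 = X ^ 2 + C (2 * a) * X := by
  rw [inverseAbelPolynomial, sum_range_succ, sum_range_succ, sum_range_one]
  simp only [Nat.choose_zero_right, Nat.cast_one, Nat.cast_zero, zero_mul, Nat.sub_zero, ne_eq,
    OfNat.ofNat_ne_zero, not_false_eq_true, zero_pow, mul_zero, zero_smul, zero_add, Nat.choose_one_right,
    Nat.cast_ofNat, Nat.cast_one, one_mul, Nat.add_one_sub_one, pow_one, Nat.choose_self, Nat.sub_self,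
    pow_zero, mul_one, one_smul, smul_eq_C_mul]
  ring

/-- **`(Eᵃ D)ᵏ = E^{ka} Dᵏ`** (`E^{ka} = taylor (ka)`). [cite: RotaKahanerOdlyzko1973, §14
("`[E^{ka} Dᵏ xⁿ]_{x=0}`"), p. 745] -/
theorem taylor_comp_derivative_pow (a : K) (k : ℕ) :
    (taylor a ∘ₗ derivative : K[X] →ₗ[K] K[X]) ^ k =
      taylor ((k : K) * a) ∘ₗ (derivative : K[X] →ₗ[K] K[X]) ^ k := by
  rw [taylor_comp_derivative_eq_diffOp, ← diffOp_pow, mul_pow, rescale_exp_pow, mul_comm (PowerSeries.X ^ k),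
    diffOp_mul, ← taylor_eq_diffOp_exp, diffOp_pow, diffOp_X]

/-- `[(Eᵃ D)ᵏ xⁿ]_{x=0} = [E^{ka} Dᵏ xⁿ]_{x=0} = n (n−1) ⋯ (n−k+1) · (ka)^{n−k}`.
[cite: RotaKahanerOdlyzko1973, §14, p. 745] -/
theorem taylor_comp_derivative_pow_X_pow_eval_zero (a : K) (k n : ℕ) :
    (((taylor a ∘ₗ derivative : K[X] →ₗ[K] K[X]) ^ k) (X ^ n)).eval 0 =
      (n.descFactorial k : K) * ((k : K) * a) ^ (n - k) := by
  rw [taylor_comp_derivative_pow, LinearMap.comp_apply, Module.End.pow_apply, iterate_derivative_X_pow_eq_smul,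
    map_smul, eval_smul, taylor_eval, zero_add, eval_pow, eval_X, smul_eq_mul]

/-- The Abel polynomials are the basic set of `(t e^{at})(D) = Eᵃ D`.
[cite: Robert2000PadicAnalysis, Ch. IV §5.5 Example, p. 202] -/
theorem isBasicSequence_abelPolynomial_diffOp (a : K) :
    IsBasicSequence (diffOp (PowerSeries.X * PowerSeries.rescale a (PowerSeries.exp K))) (abelPolynomial a) := by
  rw [← taylor_comp_derivative_eq_diffOp]
  exact isBasicSequence_abelPolynomial a

/-- `(t e^{at})(D) = Eᵃ D` is a delta operator. [cite: Robert2000PadicAnalysis, Ch. IV §5.5 Example,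
p. 202] -/
theorem isDeltaOperator_diffOp_X_mul_rescale_exp (a : K) :
    IsDeltaOperator (diffOp (PowerSeries.X * PowerSeries.rescale a (PowerSeries.exp K))) := by
  rw [← taylor_comp_derivative_eq_diffOp]
  exact isDeltaOperator_taylor_comp_derivative a

/-- The inverse operator `Ā(D)`, `Ā (t) = Σ_{n≥1} (−na)^{n−1} tⁿ/n!` the compositional inverse of
`t e^{at}`, is a delta operator. [cite: RotaKahanerOdlyzko1973, §7 Corollary 3, p. 709]
[cite: Robert2000PadicAnalysis, Ch. IV §6.2, p. 210] -/
theorem isDeltaOperator_diffOp_abelInverseSeries (a : K) :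
    IsDeltaOperator (diffOp (PowerSeries.mk fun n =>
      if n = 0 then (0 : K) else (-((n : K) * a)) ^ (n - 1) / (n.factorial : K))) := by
  refine (isDeltaOperator_diffOp_iff _).2 ⟨?_, ?_⟩
  · rw [← PowerSeries.coeff_zero_eq_constantCoeff_apply, PowerSeries.coeff_mk, if_pos rfl]
  · rw [PowerSeries.coeff_mk, if_neg one_ne_zero, Nat.sub_self, pow_zero, Nat.factorial_one, Nat.cast_one,
      div_one]
    exact one_ne_zero

/-- **`B_n^{(a)}` is the basic set of the inverse operator `Ā(D)`** ("from the summation formula we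
recognize that these are indeed the inverses of the Abel polynomials"): the basic set `r` of `Ā(D)`
satisfies `A_n (r (x)) = xⁿ` (the basic sets of `q(D)` and `q̄(D)` are inverse), so by Corollary 6
`r_n = Σ_k xᵏ/k! [(Eᵃ D)ᵏ xⁿ]_{x=0} = Σ_k C(n,k) (ka)^{n−k} xᵏ = B_n^{(a)}`.
[cite: RotaKahanerOdlyzko1973, §14, p. 745] [cite: RotaKahanerOdlyzko1973, §7 Corollary 6, p. 710] -/
theorem basicSequence_diffOp_abelInverseSeries (a : K) (n : ℕ) :
    (isDeltaOperator_diffOp_abelInverseSeries a).basicSequence n = inverseAbelPolynomial a n := by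
  have hinv : umbralComp (abelPolynomial a) (isDeltaOperator_diffOp_abelInverseSeries a).basicSequence =
      fun n => X ^ n :=
    funext ((isBasicSequence_abelPolynomial_diffOp a).umbralComp_eq_X_pow_of_subst_eq_X
      (isDeltaOperator_diffOp_abelInverseSeries a)
      (isDeltaOperator_diffOp_abelInverseSeries a).isBasicSequence_basicSequence (subst_abelInverseSeries a))
  rw [eq_sum_of_umbralComp_eq_X_pow (isDeltaOperator_taylor_comp_derivative a) (isBasicSequence_abelPolynomial a)
    hinv n, inverseAbelPolynomial]
  refine sum_congr rfl fun k _ => ?_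
  congr 1
  rw [taylor_comp_derivative_pow_X_pow_eval_zero, Nat.descFactorial_eq_factorial_mul_choose, Nat.cast_mul,
    mul_assoc, mul_div_cancel_left₀ _ (Nat.cast_ne_zero.2 (Nat.factorial_ne_zero k))]

/-- `B^{(a)} = (B_n^{(a)})_n` is the basic set of `Ā(D)`, `Ā` the compositional inverse of `t e^{at}`.
[cite: RotaKahanerOdlyzko1973, §14, p. 745] -/
theorem isBasicSequence_inverseAbelPolynomial (a : K) :
    IsBasicSequence (diffOp (PowerSeries.mk fun n =>
      if n = 0 then (0 : K) else (-((n : K) * a)) ^ (n - 1) / (n.factorial : K))) (inverseAbelPolynomial a) := by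
  have hfun : (isDeltaOperator_diffOp_abelInverseSeries a).basicSequence = inverseAbelPolynomial a :=
    funext (basicSequence_diffOp_abelInverseSeries a)
  rw [← hfun]
  exact (isDeltaOperator_diffOp_abelInverseSeries a).isBasicSequence_basicSequence

/-- `deg B_n^{(a)} = n`. [cite: RotaKahanerOdlyzko1973, §14, p. 745] -/
theorem natDegree_inverseAbelPolynomial (a : K) (n : ℕ) : (inverseAbelPolynomial a n).natDegree = n :=
  (isBasicSequence_inverseAbelPolynomial a).natDegree_eq n

/-- **`A_n (B^{(a)} (x)) = xⁿ`** — "their umbral recursion formula is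
`B^{(a)} (x) (B^{(a)} (x) − na)^{n−1} = xⁿ`". [cite: RotaKahanerOdlyzko1973, §14, p. 745] -/
theorem umbralComp_abelPolynomial_inverseAbelPolynomial (a : K) (n : ℕ) :
    umbralComp (abelPolynomial a) (inverseAbelPolynomial a) n = X ^ n :=
  (isBasicSequence_abelPolynomial_diffOp a).umbralComp_eq_X_pow_of_subst_eq_X
    (isDeltaOperator_diffOp_abelInverseSeries a) (isBasicSequence_inverseAbelPolynomial a)
    (subst_abelInverseSeries a) n

/-- **`B_n^{(a)} (A (x)) = xⁿ`**: the two sets are inverse in the other order too.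
[cite: RotaKahanerOdlyzko1973, §14, p. 745] [cite: RotaKahanerOdlyzko1973, §7 Corollary 3, p. 709] -/
theorem umbralComp_inverseAbelPolynomial_abelPolynomial (a : K) (n : ℕ) :
    umbralComp (inverseAbelPolynomial a) (abelPolynomial a) n = X ^ n :=
  (isBasicSequence_inverseAbelPolynomial a).umbralComp_eq_X_pow_of_subst_eq_X
    (isDeltaOperator_diffOp_X_mul_rescale_exp a) (isBasicSequence_abelPolynomial_diffOp a)
    (abelInverseSeries_subst a) n

/-- **"the identity stating that the two sets are inverse is
`xⁿ = Σ_{k≥0} C(n,k) (ka)^{n−k} x (x − ka)^{k−1}`"**. [cite: RotaKahanerOdlyzko1973, §14, p. 745] -/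
theorem X_pow_eq_sum_choose_mul_pow_smul_abelPolynomial (a : K) (n : ℕ) :
    (X : K[X]) ^ n = ∑ k ∈ range (n + 1), ((n.choose k : K) * ((k : K) * a) ^ (n - k)) • abelPolynomial a k := by
  rw [← umbralComp_inverseAbelPolynomial_abelPolynomial a n,
    umbralComp_eq_sum _ _ n (by rw [natDegree_inverseAbelPolynomial]; exact lt_add_one n)]
  exact sum_congr rfl fun k _ => by rw [coeff_inverseAbelPolynomial]

/-- **`B_n^{(a)} (x) = Σ_k xᵏ/k! [E^{ka} Dᵏ xⁿ]_{x=0}`** as printed — Corollary 6 for `Q = Eᵃ D`.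
[cite: RotaKahanerOdlyzko1973, §14, p. 745] [cite: RotaKahanerOdlyzko1973, §7 Corollary 6, p. 710] -/
theorem inverseAbelPolynomial_eq_sum_taylor_comp_derivative_pow (a : K) (n : ℕ) :
    inverseAbelPolynomial a n = ∑ k ∈ range (n + 1),
      ((((taylor a ∘ₗ derivative : K[X] →ₗ[K] K[X]) ^ k) (X ^ n)).eval 0 / (k.factorial : K)) • X ^ k :=
  eq_sum_of_umbralComp_eq_X_pow (isDeltaOperator_taylor_comp_derivative a) (isBasicSequence_abelPolynomial a)
    (funext (umbralComp_abelPolynomial_inverseAbelPolynomial a)) n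

/-- **The summation formula for the inverse Abel set** ("The summation formula (Corollary 7 of
Theorem 7) becomes …"): `f (B^{(a)} (x)) = Σ_k xᵏ/k! [E^{ka} Dᵏ f]_{x=0} = Σ_k xᵏ/k! · f^{(k)} (ka)`.
[cite: RotaKahanerOdlyzko1973, §14, p. 745] [cite: RotaKahanerOdlyzko1973, §7 Corollary 7, p. 711] -/
theorem umbral_inverseAbelPolynomial_eq_sum (a : K) (f : K[X]) {N : ℕ} (hN : f.natDegree < N) :
    umbral (inverseAbelPolynomial a) f =
      ∑ k ∈ range N, ((derivative^[k] f).eval ((k : K) * a) / (k.factorial : K)) • X ^ k := by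
  rw [umbral_eq_sum_of_umbralComp_eq_X_pow (isDeltaOperator_taylor_comp_derivative a)
    (isBasicSequence_abelPolynomial a) (funext (umbralComp_abelPolynomial_inverseAbelPolynomial a)) f hN]
  refine sum_congr rfl fun k _ => ?_
  rw [taylor_comp_derivative_pow, LinearMap.comp_apply, Module.End.pow_apply, taylor_eval, zero_add]

/-- `B^{(a)}` is of binomial type: `B_n^{(a)} (x + y) = Σ_k C(n,k) B_k^{(a)} (x) B_{n−k}^{(a)} (y)`
(basic sets are of binomial type). [cite: RotaKahanerOdlyzko1973, §2 Theorem 1 (a), p. 689]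
[cite: RotaKahanerOdlyzko1973, §14, p. 745] -/
theorem inverseAbelPolynomial_eval_add (a : K) (n : ℕ) (x y : K) :
    (inverseAbelPolynomial a n).eval (x + y) = ∑ k ∈ range (n + 1),
      (n.choose k : K) * (inverseAbelPolynomial a k).eval x * (inverseAbelPolynomial a (n - k)).eval y :=
  (isBasicSequence_inverseAbelPolynomial a).eval_add_self (isDeltaOperator_diffOp_abelInverseSeries a) n x y

end Abel

/-! ## The Laguerre polynomials are self-inverse -/

section Laguerre

omit [CharZero K] in
/-- The constant term of `1 − t` is `1 ≠ 0`. [cite: RotaKahanerOdlyzko1973, §11, p. 728] -/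
theorem constantCoeff_one_sub_X_ne_zero :
    PowerSeries.constantCoeff ((1 : PowerSeries K) - PowerSeries.X) ≠ 0 := by
  rw [map_sub, map_one, PowerSeries.constantCoeff_X, sub_zero]
  exact one_ne_zero

omit [CharZero K] in
/-- … and so is that of `(1 − t)^m`. [cite: RotaKahanerOdlyzko1973, §11, p. 728] -/
theorem constantCoeff_one_sub_X_pow_ne_zero (m : ℕ) :
    PowerSeries.constantCoeff (((1 : PowerSeries K) - PowerSeries.X) ^ m) ≠ 0 := by
  rw [map_pow]
  exact pow_ne_zero m (constantCoeff_one_sub_X_ne_zero K)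

variable {K} in
omit [CharZero K] in
/-- `(φ^m)⁻¹ = (φ⁻¹)^m` for an invertible series. [cite: RotaKahanerOdlyzko1973, §11, p. 728] -/
theorem powerSeries_inv_pow {φ : PowerSeries K} (hφ : PowerSeries.constantCoeff φ ≠ 0) (m : ℕ) :
    (φ ^ m)⁻¹ = φ⁻¹ ^ m := by
  symm
  rw [PowerSeries.eq_inv_iff_mul_eq_one (by rw [map_pow]; exact pow_ne_zero m hφ), ← mul_pow,
    PowerSeries.inv_mul_cancel φ hφ, one_pow]

omit [CharZero K] in
/-- `1 − t/(t − 1) = (1 − t)⁻¹` ("the operator `I/(I − D)`"). [cite: RotaKahanerOdlyzko1973, §11,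
p. 729] -/
theorem one_sub_X_mul_X_sub_one_inv :
    (1 - PowerSeries.X * (PowerSeries.X - 1 : PowerSeries K)⁻¹ : PowerSeries K) =
      ((1 : PowerSeries K) - PowerSeries.X)⁻¹ := by
  rw [PowerSeries.eq_inv_iff_mul_eq_one (constantCoeff_one_sub_X_ne_zero K)]
  have hc := PowerSeries.mul_inv_cancel (PowerSeries.X - 1 : PowerSeries K)
    (constantCoeff_X_sub_one_ne_zero K)
  linear_combination PowerSeries.X * hc

omit [CharZero K] in
/-- **The Laguerre indicator `K (t) = t/(t − 1)` is a compositional involution: `K (K (t)) = t`**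
(the series identity behind "all the Laguerre polynomials are self-inverse sets").
[cite: RotaKahanerOdlyzko1973, §11, p. 729] -/
theorem X_mul_X_sub_one_inv_subst_self :
    ((PowerSeries.X * (PowerSeries.X - 1 : PowerSeries K)⁻¹).subst
        (PowerSeries.X * (PowerSeries.X - 1 : PowerSeries K)⁻¹) : PowerSeries K) = PowerSeries.X := by
  have hπ0 : PowerSeries.constantCoeff (PowerSeries.X * (PowerSeries.X - 1 : PowerSeries K)⁻¹) = 0 := by
    rw [map_mul, PowerSeries.constantCoeff_X, zero_mul]
  have hs := PowerSeries.HasSubst.of_constantCoeff_zero' hπ0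
  have hc := PowerSeries.mul_inv_cancel (PowerSeries.X - 1 : PowerSeries K)
    (constantCoeff_X_sub_one_ne_zero K)
  have h1 : ((PowerSeries.X - 1 : PowerSeries K).subst
      (PowerSeries.X * (PowerSeries.X - 1 : PowerSeries K)⁻¹) : PowerSeries K) =
      (PowerSeries.X - 1 : PowerSeries K)⁻¹ := by
    rw [PowerSeries.subst_sub hs, PowerSeries.subst_X hs, powerSeries_one_subst hπ0]
    linear_combination hc
  rw [PowerSeries.subst_mul hs, PowerSeries.subst_X hs,
    powerSeries_inv_subst hπ0 (constantCoeff_X_sub_one_ne_zero K), h1, X_sub_one_inv_inv, mul_assoc,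
    PowerSeries.inv_mul_cancel _ (constantCoeff_X_sub_one_ne_zero K), mul_one]

/-- `(L_n)` is the basic set of `(t/(t−1))(D)`. [cite: RotaKahanerOdlyzko1973, §11 (*), p. 727] -/
theorem isBasicSequence_laguerreBasic_diffOp :
    IsBasicSequence (diffOp (PowerSeries.X * (PowerSeries.X - 1 : PowerSeries K)⁻¹)) (laguerreBasic K) := by
  rw [← laguerreOperator_eq_diffOp]
  exact isBasicSequence_laguerreBasic K

/-- `(t/(t−1))(D)` is a delta operator. [cite: RotaKahanerOdlyzko1973, §11, p. 727] -/
theorem isDeltaOperator_diffOp_X_mul_X_sub_one_inv :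
    IsDeltaOperator (diffOp (PowerSeries.X * (PowerSeries.X - 1 : PowerSeries K)⁻¹)) := by
  rw [← laguerreOperator_eq_diffOp]
  exact isDeltaOperator_laguerreOperator K

/-- **The basic Laguerre polynomials are self-inverse: `L_n (L (x)) = xⁿ`** ("This is true even of
the basic Laguerre polynomials, which correspond to the case `α = −1`").
[cite: RotaKahanerOdlyzko1973, §11, p. 729] -/
theorem umbralComp_laguerreBasic_self (n : ℕ) :
    umbralComp (laguerreBasic K) (laguerreBasic K) n = X ^ n :=
  (isBasicSequence_laguerreBasic_diffOp K).umbralComp_eq_X_pow_of_subst_eq_X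
    (isDeltaOperator_diffOp_X_mul_X_sub_one_inv K) (isBasicSequence_laguerreBasic_diffOp K)
    (X_mul_X_sub_one_inv_subst_self K) n

/-- The umbral operator `xⁿ ↦ L_n` is an involution: `umbral L ∘ umbral L = id`.
[cite: RotaKahanerOdlyzko1973, §11, p. 729] -/
theorem umbral_laguerreBasic_comp_self :
    umbral (laguerreBasic K) ∘ₗ umbral (laguerreBasic K) = LinearMap.id :=
  (umbral_comp_umbral_eq_id_iff _ _).2 (funext (umbralComp_laguerreBasic_self K))

/-- … as a statement about the map. [cite: RotaKahanerOdlyzko1973, §11, p. 729] -/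
theorem umbral_laguerreBasic_involutive : Function.Involutive (umbral (laguerreBasic K)) := fun f => by
  have h := LinearMap.congr_fun (umbral_laguerreBasic_comp_self K) f
  rwa [LinearMap.comp_apply, LinearMap.id_apply] at h

/-- **The Lah-type coefficient matrix of the `L_n` is its own inverse**: `Σ_{k ≤ n} l(n,k) L_k (x) = xⁿ`
where `L_n (x) = Σ_k l(n,k) xᵏ`. [cite: RotaKahanerOdlyzko1973, §11, p. 729] -/
theorem sum_coeff_laguerreBasic_smul_laguerreBasic (n : ℕ) :
    ∑ k ∈ range (n + 1), (laguerreBasic K n).coeff k • laguerreBasic K k = X ^ n := by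
  rw [← umbralComp_laguerreBasic_self K n,
    umbralComp_eq_sum _ _ n (by rw [natDegree_laguerreBasic]; exact lt_add_one n)]

/-- **Umbral composition of two Laguerre sets** ("a trivial identification of the various operators
at hand yields `L_n^{(α)} (L^{(β)} (x)) = (I − D)^{β−α} xⁿ`"), in the tree's integral indexing
`laguerreSheffer K m = L^{(m−1)} = (I − D)^m L`: by Theorem 7 with `q (p (t)) = t` and
`(1 − K (t))^a = (1 − t)^{−a}`, `L^{(a−1)} (L^{(b−1)} (x)) = ((I − D)^b (I − D)^{−a}) xⁿ`.
[cite: RotaKahanerOdlyzko1973, §11, p. 729] [cite: RotaKahanerOdlyzko1973, §7 Theorem 7, p. 708] -/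
theorem umbralComp_laguerreSheffer (a b n : ℕ) :
    umbralComp (laguerreSheffer K a) (laguerreSheffer K b) n =
      diffOp (((1 : PowerSeries K) - PowerSeries.X) ^ b * (((1 : PowerSeries K) - PowerSeries.X) ^ a)⁻¹)
        (X ^ n) := by
  have hπ0 : PowerSeries.constantCoeff (PowerSeries.X * (PowerSeries.X - 1 : PowerSeries K)⁻¹) = 0 := by
    rw [map_mul, PowerSeries.constantCoeff_X, zero_mul]
  have hs := PowerSeries.HasSubst.of_constantCoeff_zero' hπ0
  have hσ : ((((1 : PowerSeries K) - PowerSeries.X) ^ a).subst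
      (PowerSeries.X * (PowerSeries.X - 1 : PowerSeries K)⁻¹) : PowerSeries K) =
      (((1 : PowerSeries K) - PowerSeries.X) ^ a)⁻¹ := by
    rw [PowerSeries.subst_pow hs, PowerSeries.subst_sub hs, powerSeries_one_subst hπ0, PowerSeries.subst_X hs,
      one_sub_X_mul_X_sub_one_inv, ← powerSeries_inv_pow (constantCoeff_one_sub_X_ne_zero K)]
  rw [umbralComp_eq_diffOp_apply (isDeltaOperator_diffOp_X_mul_X_sub_one_inv K)
    (isBasicSequence_laguerreBasic_diffOp K) (((1 : PowerSeries K) - PowerSeries.X) ^ a)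
    (((1 : PowerSeries K) - PowerSeries.X) ^ b) (s := laguerreSheffer K a) (t := laguerreSheffer K b)
    (q := laguerreBasic K) (fun n => rfl) (fun n => rfl) n, umbralComp_laguerreBasic_self, hσ]

/-- **"all the Laguerre polynomials are self-inverse sets": `L_n^{(α)} (L^{(α)} (x)) = xⁿ`.**
[cite: RotaKahanerOdlyzko1973, §11, p. 729] -/
theorem umbralComp_laguerreSheffer_self (a n : ℕ) :
    umbralComp (laguerreSheffer K a) (laguerreSheffer K a) n = X ^ n := by
  rw [umbralComp_laguerreSheffer, PowerSeries.mul_inv_cancel _ (constantCoeff_one_sub_X_pow_ne_zero K a),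
    diffOp_one, LinearMap.id_apply]

/-- `L_n^{(α)} (L^{(β)} (x)) = (I − D)^{β−α} xⁿ` for `β ≥ α` (`β − α = c`).
[cite: RotaKahanerOdlyzko1973, §11, p. 729] -/
theorem umbralComp_laguerreSheffer_add (a c n : ℕ) :
    umbralComp (laguerreSheffer K a) (laguerreSheffer K (a + c)) n =
      diffOp (((1 : PowerSeries K) - PowerSeries.X) ^ c) (X ^ n) := by
  rw [umbralComp_laguerreSheffer, pow_add, mul_comm (((1 : PowerSeries K) - PowerSeries.X) ^ a), mul_assoc,
    PowerSeries.mul_inv_cancel _ (constantCoeff_one_sub_X_pow_ne_zero K a), mul_one]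

/-- `L_n^{(α)} (L^{(β)} (x)) = (I − D)^{β−α} xⁿ` for `β ≤ α` (`α − β = c`, the operator
`((I − D)^c)⁻¹`). [cite: RotaKahanerOdlyzko1973, §11, p. 729] -/
theorem umbralComp_laguerreSheffer_add' (a c n : ℕ) :
    umbralComp (laguerreSheffer K (a + c)) (laguerreSheffer K a) n =
      diffOp ((((1 : PowerSeries K) - PowerSeries.X) ^ c)⁻¹) (X ^ n) := by
  rw [umbralComp_laguerreSheffer, pow_add, PowerSeries.mul_inv_rev, mul_left_comm,
    PowerSeries.mul_inv_cancel _ (constantCoeff_one_sub_X_pow_ne_zero K a), mul_one]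

/-- The umbral operator `xⁿ ↦ L_n^{(α)}` is an involution for every `α`.
[cite: RotaKahanerOdlyzko1973, §11, p. 729] -/
theorem umbral_laguerreSheffer_comp_self (a : ℕ) :
    umbral (laguerreSheffer K a) ∘ₗ umbral (laguerreSheffer K a) = LinearMap.id :=
  (umbral_comp_umbral_eq_id_iff _ _).2 (funext (umbralComp_laguerreSheffer_self K a))

end Laguerre

/-! ## The Laguerre polynomials in terms of `φ_n (−x)` (RKO §14, p. 748) -/

section LaguerreTouchard

variable {K} in
omit [CharZero K] in
/-- Substituting a rescaled series: `f (g (at)) = (f ∘ g)(at)`. [cite: RotaKahanerOdlyzko1973, §7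
(before Proposition 4), p. 711] -/
theorem subst_rescale_eq_rescale_subst (f : PowerSeries K) {g : PowerSeries K}
    (hg : PowerSeries.constantCoeff g = 0) (a : K) :
    (f.subst (PowerSeries.rescale a g) : PowerSeries K) = PowerSeries.rescale a (f.subst g) := by
  rw [PowerSeries.rescale_eq_subst, PowerSeries.rescale_eq_subst,
    PowerSeries.subst_comp_subst_apply (PowerSeries.HasSubst.of_constantCoeff_zero' hg)
      (PowerSeries.HasSubst.smul_X' a)]

/-- `e^{log (1 + t)} = 1 + t`. [cite: Robert2000PadicAnalysis, Ch. IV §6.2 Example 1, p. 210] -/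
theorem exp_subst_log :
    ((PowerSeries.exp K).subst (PowerSeries.log K) : PowerSeries K) = 1 + PowerSeries.X := by
  have h := exp_sub_one_subst_log (K := K)
  rw [PowerSeries.subst_sub (PowerSeries.HasSubst.of_constantCoeff_zero' PowerSeries.constantCoeff_log),
    powerSeries_one_subst PowerSeries.constantCoeff_log] at h
  linear_combination h

/-- The constant term of `e^t` is `1 ≠ 0`. [cite: Robert2000PadicAnalysis, Ch. IV §6.2, p. 210] -/
theorem constantCoeff_exp_ne_zero : PowerSeries.constantCoeff (PowerSeries.exp K) ≠ 0 := by
  rw [PowerSeries.constantCoeff_exp]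
  exact one_ne_zero

/-- `e^{−t} = (e^t)⁻¹`. [cite: Robert2000PadicAnalysis, Ch. IV §6.2 Example 2, p. 211] -/
theorem rescale_neg_one_exp_eq_inv :
    PowerSeries.rescale (-1) (PowerSeries.exp K) = (PowerSeries.exp K)⁻¹ := by
  rw [PowerSeries.eq_inv_iff_mul_eq_one (constantCoeff_exp_ne_zero K), mul_comm]
  exact PowerSeries.exp_mul_exp_neg_eq_one

/-- The constant term of `log (1 − t)` is `0`. [cite: RotaKahanerOdlyzko1973, §14, p. 748] -/
theorem constantCoeff_rescale_neg_one_log :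
    PowerSeries.constantCoeff (PowerSeries.rescale (-1) (PowerSeries.log K)) = 0 := by
  rw [← PowerSeries.coeff_zero_eq_constantCoeff_apply, PowerSeries.coeff_rescale, pow_zero, one_mul,
    PowerSeries.coeff_zero_eq_constantCoeff_apply, PowerSeries.constantCoeff_log]

/-- **"we must find a formal power series `f (t)` such that `f (log (1 − t)) = t/(t − 1)`. Clearly
`f (t) = 1 − e^{−t}` is the desired series."** [cite: RotaKahanerOdlyzko1973, §14, p. 748] -/
theorem one_sub_exp_neg_subst_log_one_sub :
    ((1 - PowerSeries.rescale (-1) (PowerSeries.exp K)).subst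
        (PowerSeries.rescale (-1) (PowerSeries.log K)) : PowerSeries K) =
      PowerSeries.X * (PowerSeries.X - 1 : PowerSeries K)⁻¹ := by
  have hs := PowerSeries.HasSubst.of_constantCoeff_zero' (constantCoeff_rescale_neg_one_log K)
  rw [PowerSeries.subst_sub hs, powerSeries_one_subst (constantCoeff_rescale_neg_one_log K),
    rescale_neg_one_exp_eq_inv, powerSeries_inv_subst (constantCoeff_rescale_neg_one_log K)
      (constantCoeff_exp_ne_zero K),
    subst_rescale_eq_rescale_subst _ PowerSeries.constantCoeff_log (-1), exp_subst_log, map_add, map_one,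
    PowerSeries.rescale_neg_one_X, ← sub_eq_add_neg, ← one_sub_X_mul_X_sub_one_inv, sub_sub_cancel]

/-- `log (1 − D)` is a delta operator. [cite: RotaKahanerOdlyzko1973, §14, p. 748] -/
theorem isDeltaOperator_diffOp_rescale_neg_one_log :
    IsDeltaOperator (diffOp (PowerSeries.rescale (-1) (PowerSeries.log K))) := by
  have h := (isDeltaOperator_diffOp_log (K := K)).rescale (b := (-1 : K)) (neg_ne_zero.2 one_ne_zero)
  rwa [inv_neg_one] at h

/-- **"the `φ_n (−x)` are basic for the delta operator `log (I − D)`"** (Proposition 4 with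
`b = −1`). [cite: RotaKahanerOdlyzko1973, §14, p. 748] [cite: RotaKahanerOdlyzko1973, §7
Proposition 4, p. 711] -/
theorem isBasicSequence_touchardPolynomial_comp_neg_X :
    IsBasicSequence (diffOp (PowerSeries.rescale (-1) (PowerSeries.log K)))
      fun n => (touchardPolynomial K n).comp (-X) := by
  have h := (isBasicSequence_touchardPolynomial K).comp_C_mul_X (b := (-1 : K)) (neg_ne_zero.2 one_ne_zero)
  rwa [inv_neg_one, C_neg, C_1, neg_one_mul] at h

/-- `x (x+1) ⋯ (x+n−1)` is the basic set of `∇ = (1 − e^{−t})(D)`.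
[cite: Robert2000PadicAnalysis, Ch. IV §6.2 Example 2, p. 211] [cite: RotaKahanerOdlyzko1973, §14,
p. 748] -/
theorem isBasicSequence_ascPochhammer_diffOp :
    IsBasicSequence (diffOp (1 - PowerSeries.rescale (-1) (PowerSeries.exp K))) (ascPochhammer K) := by
  rw [← backwardDifference_eq_diffOp]
  exact isBasicSequence_ascPochhammer

/-- **The Laguerre polynomials connected with `φ_n (−x)`**: "The connection constants are therefore
given by the coefficients of the basic sequence for the backward difference operator
`∇ = I − E^{−1}`, namely the polynomials `x (x + 1) ⋯ (x + n − 1)`" — umbrally,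
`L_n (x) = ⟨φ (−x)⟩_n` (Corollary 1: `⟨φ(−x)⟩_n` is basic for `(1 − e^{−t}) ∘ log (1 − t) = t/(t−1)`,
the Laguerre operator). [cite: RotaKahanerOdlyzko1973, §14, p. 748] [cite: RotaKahanerOdlyzko1973, §7
Corollary 1, p. 709] -/
theorem laguerreBasic_eq_umbralComp_ascPochhammer (n : ℕ) :
    laguerreBasic K n = umbralComp (ascPochhammer K) (fun k => (touchardPolynomial K k).comp (-X)) n := by
  have h := (isBasicSequence_touchardPolynomial_comp_neg_X K).umbralComp_diffOp_subst
    (isDeltaOperator_diffOp_rescale_neg_one_log K) (isBasicSequence_ascPochhammer_diffOp K)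
  rw [one_sub_exp_neg_subst_log_one_sub, ← laguerreOperator_eq_diffOp] at h
  show (isDeltaOperator_laguerreOperator K).basicSequence n = _
  rw [← h.eq_basicSequence (isDeltaOperator_laguerreOperator K)]

/-- **`L_n (x) = Σ_{k ≤ n} c(n,k) φ_k (−x)`**, `c(n,k) = [xᵏ] x (x+1) ⋯ (x+n−1)` the signless Stirling
numbers of the first kind. [cite: RotaKahanerOdlyzko1973, §14, p. 748] -/
theorem laguerreBasic_eq_sum_coeff_ascPochhammer_smul (n : ℕ) :
    laguerreBasic K n =
      ∑ k ∈ range (n + 1), (ascPochhammer K n).coeff k • (touchardPolynomial K k).comp (-X) := by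
  rw [laguerreBasic_eq_umbralComp_ascPochhammer,
    umbralComp_eq_sum _ _ n (by rw [ascPochhammer_natDegree]; exact lt_add_one n)]

end LaguerreTouchard

end Literature.Algebra.Polynomial
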